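import Literature.MathematicalPhysics.QuantumFieldTheory.Balaban1983to89.B6AgreeQaQV1Chart
import Literature.MathematicalPhysics.QuantumFieldTheory.Balaban1983to89.B6GlobalChartV1L0
import Literature.MathematicalPhysics.QuantumFieldTheory.Balaban1983to89.B6MultiLevelTorusOperatorL0
import Literature.MathematicalPhysics.QuantumFieldTheory.Balaban1983to89.B6IndexCorrV1

/-!
# `Balaban1983to89.B6IndexCorrV1L0` — LEVEL-0 TWIN (programme G-F3′-L0, director-ym LINE №27 / UV3-NODE §24.5; plan `lit-balaban-r03/G-F3L0-PLAN.md`) of `B6IndexCorrV1`: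
the same declarations, SAME NAMES AND STATEMENTS, for nested families WITH print's region `Λ₀ = T ∖ Ω₁` ADMITTED (structures
`B6MultiLevelBoxOperatorL0.Domains` / `B6MultiLevelTorusOperatorL0.TDomains`: levels `0, …, k`, the level-`0` block a single site, `Q′₀ = id`,
finite weight `a₀` — print p.225 (2.14) «Σ_{j=0}^k … (Q′₀λ)(x) = λ(x), x ∈ Λ₀», p.229 «taking a sequence (2.1) … smallest possible domains B^j(Λ_j),
and considering the operator Δ_a defined by (2.19), (2.20) for this sequence»).  Every `D`-free object is the lineage's, consumed BY NAME; no existing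
module is touched; no fact is minted.  Unit `lit-balaban-r03` (B6 fold owner, r03 gen 36); referee ref-4.  THE TWIN'S DOCUMENTATION FOLLOWS
VERBATIM (its «levels 1 … k» / «Ω₁ = X» sentences describe the twin; here `j` runs from `0` and `Ω₁` may be a proper subset).

# `Balaban1983to89.B6IndexCorrV1` — T. Bałaban, *Propagators and renormalization transformations for lattice gauge theories. II*, Commun.
# Math. Phys. **96** (1984) 223–250 [Balaban1984PropagatorsII], (2.89) p. 239 with (2.1)–(2.3) p. 224: THE INDEX SETS `Λ_j`, `Λ_{j+1}` OF `𝔅`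
# NEAR A CUBE `□` OF THE `L^{−j}`-SCALE ARE THE MEMBER'S `Λ^c(□) ⊔ Λ′(□)` THROUGH THE LEVEL CHARTS, AND NO OTHER LEVEL IS SEEN — the
# index-set correspondence hypotheses `hL0`, `hLj`, `hLj1` of `B6AgreeQaQV1Chart.kagree_QaQ` DISCHARGED for the V1 domain datum
# `B6GlobalChartV1L0.domT` of p21's torus family from the two-level window, the definition (2.89) of `Λ′(□)` and the separation (2.2) near `□`
# (item (d5-a) of the B6 fold owner's programme for the genuine k-level Proposition 2.6, B6-CLOSURE.md §5 items 9–11)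

statement-level skeleton of published theorems with citation tags; proofs where landed; nothing here is a claim about the Yang–Mills mass gap

PDF held: `paper:balaban1984-cmp96-propagators-rt-ii` (journal page = PDF page + 222); p. 224 [PDF 2] ((2.1)–(2.3): Ω₁ ⊃ … ⊃ Ω_k unions of big
blocks, the separation (2.2), `Λ_j = Ω_j ∖ Ω_{j+1}` for sites and bonds), p. 238–239 [PDF 16–17] (*"Let us take a cube □ connected with a
L^{−j}-scale, i.e. either □ ⊂ B_j(Λ_j), or it intersects also B_{j+1}(Λ_{j+1}) … On this torus we define operators R, Δ_a as in (2.17), (2.19), but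
only two scales are present now. We define B^j(Λ′) = □̃² ∩ B^{j+1}(Λ_{j+1}), (2.89)"*).

CITATION HEADER (lean-in-tree rule) — WHAT IS REPRODUCED.  Phase-2 file of the `lit-balaban` typed skeleton (HOME `run/shared/lean/pub/lit-balaban/`),
unit `lit-balaban-r03` (B6 fold owner; r03 gen 19, literature-prover-lit-balaban-r03-g19-0), referee ref-4.  SKELETON rows **B6.Eq2.89** × **B6.Eq2.91**
× **B6.Eq2.1-2.3** × **B6.Prop2.6** (cells; decls of record untouched).  IMPORTS BY NAME, restating nothing: `B6AgreeQaQV1Chart` (`eSj`/`eBj`,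
`iterBlockOf_eS`, `val_eSj`, `iterBlockOf_window`, `eSj_inj`, `deepS_of_iterBlockOf_eq`, `deep_block_of_near`, `window_of_deep_block`,
`blocks_of_bondAvgIter_single_ne_zero`, `NearB`, **`kagree_QaQ`**, `KAgree.mul_mulOp` via `B6AgreeLapV1Chart`), `B6AgreeLapV1Chart` (`DeepS/DeepB`,
`cB`, `agree_lapV_member`, `transplant_eB_eq`), `B6GlobalChartV1` (`PV`, `toBox`, **`domT`**, **`iterBlockOf_mem_domT_iff`**), `B6SectADomainsV1.Domains`
(`Om`, `Deep`, `LamBond`, `not_deep_of_le`), `B6MultiLevelTorusOperatorL0.TDomains` (`lev`), `B5Eq118OneStroke` (`iterBlockOf`, `val_iterBlockOf`),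
`TorusGeometry` (`Site.val_blockOf`), `B6Prop26ReachTransplant` (`transplant`, `transplant_add`, `chartBond`).

THIS FILE (0 sorry; standard axioms; NO new definition, NO `def … : Prop`).
* §1 charts one level up: `eSj_shift_of_val` (the level chart intertwines `y ↦ y + e_μ` where the global label does not wrap), `val_shift_of_window`
  (no wrap below the top row of the window), **`blockOf_eSj`** (`blockOf (e_{j′} y) = e_{j′+1}(blockOf y)` on window blocks, corner `x₀ ∈ L^{j′+1}ℤ^{d+1}`),
  `eBj_tgt`, **`blockLabel_of_deep`** (a site of margin `n·L^k` has block label in `[x₀/L^k + n, x₀/L^k + N′_k − n)`), **`deepS_of_iterBlockOf_shift`**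
  (the block above a deep block keeps the margin minus `2L^k`).
* §2 `deep_bigBlock_of_deep_block`, `deep_tgtBlock_of_deep_block`, `val_tgt_of_deep_block`; **`lamBond_iff_chart_out`** (= `hLj`: a near `j`-bond is in
  `Λ_j` iff both end-blocks of its chart are off `Λ′`), **`lamBond_succ_iff_chart_in`** (= `hLj1`: a near `(j+1)`-bond is in `Λ_{j+1}` iff an end-point
  of its chart is in `Λ′`; no window block is deep at level `j + 1`), **`not_near_of_level_ne`** (= `hL0`: levels `< j` by `hlev` alone; levels `≥ j + 2`
  by the separation input `hfar`).
* §3 **`kagree_QaQ_domT`** (`KAgree cB cB s (onFun Q*aQ) (onFun (Q*aQ)_□) (DeepB r)` for `Dm := domT hN D hk`, `r ≥ 4L^{j+1}`) and **`hagree_domT`**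
  (`M·h_□ = (c′/L^j)²•(ε(Δ_□ + Q*a_□Q)ρ)·h_□`, `M = ∂*∂ + ∂∂* + Q*aQ` over `domT`; the `hagree` of the k-level assembly) from the WINDOW DATA only:
  `hlev` (every window site has level `j` or `j + 1`), `hΛ` (the member's `Λ′` is the `e_{j+1}`-image of `Ω_{j+1} ∩ window` — print's (2.89)
  `B^j(Λ′) = □̃² ∩ B^{j+1}(Λ_{j+1})`, a property of the member CONSTRUCTED in the assembly), `hfar` (no `n`-block adjacent to the `n`-block of a deep
  window site lies in `Ω_n` for `j + 2 ≤ n ≤ k` — (2.2) near `□`), and the weight correspondence `w = (c′/L^j)²·w_□` (a property of the constructed member).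

HONEST SCOPE / DIVERGENCES. (1) `1 ≤ j` and `j + 1 ≤ k` (a cube of an intermediate scale; the top scale `j = k` — one scale only, `Λ′ = ∅` — and
p21's reading `Ω₁ = T_η` (no `Λ₀`) are not treated here). (2) `hfar` is NOT derived from `B6MultiLevelTorusOperator.TDomains.sepT` in this file: that derivation needs the cube
to contain a site of level `j` and `diam_T(window) + 2L^n < R·M_h·L^{n−1}` for `n ≥ j + 2` (p. 238: *"□ connected with a L^{−j}-scale"*), i.e.
`R` and `M_h/L` not too small — left to the assembly (d5-b) where the cubes are p21's `cubeSetT`. (3) `hΛ` and the weights are hypotheses about the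
member `t`, satisfied BY CONSTRUCTION of `t(□)` in (d5-b) (`Λ′(□) := e_{j+1}(Ω_{j+1} ∩ window)`, `w_□ := w ∘ e⁻¹/(c′/L^j)²` — the weight band
`a₀(L^j)^{d+1} ≤ w_□ ≤ a₁(L^j)^{d+1}` of `TSIdx` then constrains the global weights). (4) Margin `4L^{j+1}` for the support of `h_□`.
Value = typed skeleton: the geometric half of the third ring hypothesis of (2.91); NOT summit progress.
-/

noncomputable section

open scoped BigOperators
open Finset

namespace Literature.MathematicalPhysics.QuantumFieldTheory.Balaban1983to89.B6IndexCorrV1L0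

open B6Prop25TwoScaleCensus (TSIdx)
open B6GlobalChartV1 (PV toBox)
open B6GlobalChartV1L0 (domT iterBlockOf_mem_domT_iff)
open B6AgreeLapV1Chart
open B6AgreeQaQV1Chart
open B6Prop26ReachTransplant (transplant_add)
open B5Eq118OneStroke (iterBlockOf iterBlock mem_iterBlock val_iterBlockOf iterBlockOf_zero iterBlockOf_succ)
open B6MultiLevelBoxOperator (N0)
open B6MultiLevelTorusOperatorL0 (TDomains)
open LatticeFieldCalculus (bondAvgIter)
open Literature.MathematicalPhysics.QuantumFieldTheory.Balaban1983to89.B6IndexCorrV1 (eSj_shift_of_val val_shift_of_window blockOf_eSj eBj_tgt blockLabel_of_deep deepS_of_iterBlockOf_shift deep_bigBlock_of_deep_block deep_tgtBlock_of_deep_block val_tgt_of_deep_block)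

variable {d ℓ : ℕ} {hd : 1 ≤ d + 1} {hL : Odd (ℓ + 1) ∧ 1 < ℓ + 1} {a₀ a₁ : ℝ} {m K : ℕ}
variable {t : TSIdx d (ℓ + 1) hd hL a₀ a₁} {x₀ : Fin (d + 1) → ℤ}

/-! ## §1  The level charts one level up: `blockOf ∘ e_{j′} = e_{j′+1} ∘ blockOf` on window blocks; `e_{j′}` intertwines `y ↦ y + e_μ` -/

section Charts

/-- `val (y + e_μ)_μ = val y_μ + 1` away from the seam. [folklore] -/
private theorem qval_shift_self {P : Params} {j : ℕ} (x : Site P j) (μ : Fin P.d) (h : (x μ).val + 1 < P.sitesPerDir j) :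
    ((x.shift μ) μ).val = (x μ).val + 1 := by
  have h1 : (x.shift μ) μ = x μ + 1 := by simp [Site.shift]
  rw [h1, ZMod.val_add_of_lt (by rw [ZMod.val_one]; exact h), ZMod.val_one]

/-- the other coordinates of `x + e_μ`. [folklore] -/
private theorem qshift_apply_ne {P : Params} {j : ℕ} (x : Site P j) {μ ν : Fin P.d} (h : ν ≠ μ) : (x.shift μ) ν = x ν := by
  simp [Site.shift, Function.update_of_ne h]

/-- labels with the same quotient by `n` differ by less than `n`. [folklore] -/
private theorem near_of_div_eq' {a b n : ℕ} (hn : 0 < n) (h : a / n = b / n) : a < b + n ∧ b < a + n := by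
  have h1 := Nat.lt_div_mul_add (a := a) hn
  have h2 := Nat.div_mul_le_self b n
  have h3 := Nat.lt_div_mul_add (a := b) hn
  have h4 := Nat.div_mul_le_self a n
  rw [h] at h1
  rw [← h] at h3
  constructor <;> omega

/-- labels with consecutive quotients by `n`: `a < b < a + 2n`. [folklore] -/
private theorem near_of_div_succ' {a b n : ℕ} (hn : 0 < n) (h : a / n + 1 = b / n) : a < b ∧ b < a + 2 * n := by
  have h1 := Nat.lt_div_mul_add (a := a) hn
  have h3 := Nat.lt_div_mul_add (a := b) hn
  have h2 := Nat.div_mul_le_self b n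
  have h4 := Nat.div_mul_le_self a n
  have h5 : b / n * n = a / n * n + n := by rw [← h, Nat.add_mul, one_mul]
  rw [h5] at h2 h3
  constructor <;> omega

end Charts

/-! ## §2  THE INDEX SETS THROUGH THE CHARTS: `Λ_j ↔ Λ^c(□)` and `Λ_{j+1} ↔ Λ′(□)` near `□` — the hypotheses `hLj`, `hLj1` of
`B6AgreeQaQV1Chart.kagree_QaQ` DISCHARGED from the two-level window and the definition (2.89) of `Λ′(□)` -/

section IndexSets

variable {Mh k R : ℕ} {P' : Fin (d + 1) → ℕ}

/-- **`hLj` DISCHARGED — `Λ_j` NEAR `□` IS `Λ^c(□)` THROUGH THE CHART**: for the V1 domain datum `domT` of p21's torus family, a two-level window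
(every window site has level `j` or `j + 1`, `hlev`) and a member whose `Λ′` is the chart image of `Ω_{j+1} ∩ window` ((2.89): `B^j(Λ′) = □̃² ∩
B^{j+1}(Λ_{j+1})`, `hΛ`), a `j`-bond `β` whose block keeps the margin `L^{j+1} + 2L^j` is in `Λ_j` iff both end-blocks of its chart are off `Λ′`.
[cite: Balaban1984PropagatorsII, (2.3) p.224, (2.89) p.239] -/
theorem lamBond_iff_chart_out (hN : ∀ μ, N0 ℓ Mh k P' μ = (PV d ℓ m K hd hL).sitesPerDir 0) (D : B6MultiLevelTorusOperatorL0.TDomains d ℓ Mh k P' R) (hk : k ≤ m + K)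
    (hfit : ∀ μ, x₀ μ + (t.P.sitesPerDir 0 : ℕ) ≤ ((PV d ℓ m K hd hL).sitesPerDir 0 : ℕ))
    (hjk : t.j + 1 ≤ k) (hdiv : ∀ μ, ((((ℓ + 1) ^ (t.j + 1) : ℕ) : ℤ)) ∣ x₀ μ)
    (hlev : ∀ x : Site (PV d ℓ m K hd hL) 0, x ∈ DeepS t x₀ 0 → t.j ≤ D.lev (toBox hN x) ∧ D.lev (toBox hN x) ≤ t.j + 1)
    (hΛ : ∀ Y : Site (PV d ℓ m K hd hL) (t.j + 1), (∀ x, iterBlockOf (t.j + 1) x = Y → x ∈ DeepS t x₀ 0) →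
      (eSj t x₀ (t.j + 1) Y ∈ t.Λ' ↔ Y ∈ (domT hN D hk).Om (t.j + 1)))
    {β : PBond (PV d ℓ m K hd hL) t.j} (hβ : ∀ x, iterBlockOf t.j x = β.src → x ∈ DeepS t x₀ ((ℓ + 1) ^ (t.j + 1) + 2 * (ℓ + 1) ^ t.j)) :
    (domT hN D hk).LamBond t.j β ↔ (blockOf (eBj t x₀ t.j β).src ∉ t.Λ' ∧ blockOf (eBj t x₀ t.j β).tgt ∉ t.Λ') := by
  have hjm : t.j + 1 ≤ m + K := by omega
  have hjt : t.j + 1 ≤ t.m + t.K := t.hj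
  have hdivj : ∀ μ, ((((ℓ + 1) ^ t.j : ℕ) : ℤ)) ∣ x₀ μ := fun μ =>
    (Int.natCast_dvd_natCast.2 (pow_dvd_pow (ℓ + 1) (Nat.le_succ t.j))).trans (hdiv μ)
  -- the blocks around `β`
  have hsrc0 : ∀ x, iterBlockOf t.j x = β.src → x ∈ DeepS t x₀ 0 := fun x hx => deepS_mono (Nat.zero_le _) (hβ x hx)
  have hbig_src : ∀ x, iterBlockOf (t.j + 1) x = blockOf β.src → x ∈ DeepS t x₀ 0 :=
    deep_bigBlock_of_deep_block hjm (r := 0) fun x hx => deepS_mono (by omega) (hβ x hx)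
  have htgt : ∀ x, iterBlockOf t.j x = β.tgt → x ∈ DeepS t x₀ ((ℓ + 1) ^ (t.j + 1)) :=
    deep_tgtBlock_of_deep_block (by omega) (by omega) hdivj hfit hβ
  have hbig_tgt : ∀ x, iterBlockOf (t.j + 1) x = blockOf β.tgt → x ∈ DeepS t x₀ 0 :=
    deep_bigBlock_of_deep_block hjm (r := 0) fun x hx => by rw [zero_add]; exact htgt x hx
  have hv : ((β.src.shift β.dir) β.dir).val = (β.src β.dir).val + 1 :=
    val_tgt_of_deep_block (by omega) (by omega) hdivj hfit (r := 0) fun x hx =>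
      deepS_mono (by have := Nat.one_le_pow (t.j + 1) (ℓ + 1) (Nat.succ_pos ℓ); omega) (hβ x hx)
  -- (1) `β₋ ∈ Ω_j`: its block has level ≥ j
  have hsrcOm : β.src ∈ (domT hN D hk).Om t.j := by
    obtain ⟨x, hx⟩ := iterBlock_nonempty (P := PV d ℓ m K hd hL) (by omega : t.j ≤ m + K) β.src
    rw [mem_iterBlock] at hx
    rw [← hx]
    exact (iterBlockOf_mem_domT_iff hN D hk (by omega) x).2 (hlev x (hsrc0 x hx)).1
  -- (2) `Deep j β₋ ↔` the chart's block is in `Λ′`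
  have hdeep_src : (domT hN D hk).Deep t.j β.src ↔ blockOf (eBj t x₀ t.j β).src ∈ t.Λ' := by
    show blockOf β.src ∈ (domT hN D hk).Om (t.j + 1) ↔ blockOf (eSj t x₀ t.j β.src) ∈ t.Λ'
    rw [← hΛ _ hbig_src, blockOf_eSj hjm hjt hdiv (window_of_deep_block (by omega) (by omega) hdivj hsrc0)]
  -- (3) the same for `β₊`
  have hdeep_tgt : (domT hN D hk).Deep t.j β.tgt ↔ blockOf (eBj t x₀ t.j β).tgt ∈ t.Λ' := by
    rw [eBj_tgt hv]
    show blockOf β.tgt ∈ (domT hN D hk).Om (t.j + 1) ↔ blockOf (eSj t x₀ t.j β.tgt) ∈ t.Λ'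
    rw [← hΛ _ hbig_tgt, blockOf_eSj hjm hjt hdiv (window_of_deep_block (by omega) (by omega) hdivj
      (fun x hx => deepS_mono (Nat.zero_le _) (htgt x hx)))]
  show ((β.src ∈ (domT hN D hk).Om t.j ∨ β.tgt ∈ (domT hN D hk).Om t.j) ∧ ¬ (domT hN D hk).Deep t.j β.src ∧
      ¬ (domT hN D hk).Deep t.j β.tgt) ↔ _
  rw [hdeep_src, hdeep_tgt]
  exact ⟨fun h => ⟨h.2.1, h.2.2⟩, fun h => ⟨Or.inl hsrcOm, h.1, h.2⟩⟩

/-- **`hLj1` DISCHARGED — `Λ_{j+1}` NEAR `□` IS `Λ′(□)` THROUGH THE CHART**: under the same data, a `(j+1)`-bond `η` whose block keeps the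
margin `2L^{j+1}` is in `Λ_{j+1}` iff an end-point of its chart is in `Λ′` (no window site is deep at level `j + 1`: its `(j+2)`-block
contains sites of level `≤ j + 1`). [cite: Balaban1984PropagatorsII, (2.3) p.224, (2.89) p.239] -/
theorem lamBond_succ_iff_chart_in (hN : ∀ μ, N0 ℓ Mh k P' μ = (PV d ℓ m K hd hL).sitesPerDir 0) (D : B6MultiLevelTorusOperatorL0.TDomains d ℓ Mh k P' R) (hk : k ≤ m + K)
    (hfit : ∀ μ, x₀ μ + (t.P.sitesPerDir 0 : ℕ) ≤ ((PV d ℓ m K hd hL).sitesPerDir 0 : ℕ))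
    (hjk : t.j + 1 ≤ k) (hdiv : ∀ μ, ((((ℓ + 1) ^ (t.j + 1) : ℕ) : ℤ)) ∣ x₀ μ)
    (hlev : ∀ x : Site (PV d ℓ m K hd hL) 0, x ∈ DeepS t x₀ 0 → t.j ≤ D.lev (toBox hN x) ∧ D.lev (toBox hN x) ≤ t.j + 1)
    (hΛ : ∀ Y : Site (PV d ℓ m K hd hL) (t.j + 1), (∀ x, iterBlockOf (t.j + 1) x = Y → x ∈ DeepS t x₀ 0) →
      (eSj t x₀ (t.j + 1) Y ∈ t.Λ' ↔ Y ∈ (domT hN D hk).Om (t.j + 1)))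
    {η : PBond (PV d ℓ m K hd hL) (t.j + 1)} (hη : ∀ x, iterBlockOf (t.j + 1) x = η.src → x ∈ DeepS t x₀ (2 * (ℓ + 1) ^ (t.j + 1))) :
    (domT hN D hk).LamBond (t.j + 1) η ↔ ((eBj t x₀ (t.j + 1) η).src ∈ t.Λ' ∨ (eBj t x₀ (t.j + 1) η).tgt ∈ t.Λ') := by
  have hjm : t.j + 1 ≤ m + K := by omega
  have hjt : t.j + 1 ≤ t.m + t.K := t.hj
  have hsrc0 : ∀ x, iterBlockOf (t.j + 1) x = η.src → x ∈ DeepS t x₀ 0 := fun x hx => deepS_mono (Nat.zero_le _) (hη x hx)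
  have htgt0 : ∀ x, iterBlockOf (t.j + 1) x = η.tgt → x ∈ DeepS t x₀ 0 :=
    deep_tgtBlock_of_deep_block hjm hjt hdiv hfit (r := 0) fun x hx => by rw [zero_add]; exact hη x hx
  have hv : ((η.src.shift η.dir) η.dir).val = (η.src η.dir).val + 1 :=
    val_tgt_of_deep_block hjm hjt hdiv hfit (r := 0) fun x hx =>
      deepS_mono (by have := Nat.one_le_pow (t.j + 1) (ℓ + 1) (Nat.succ_pos ℓ); omega) (hη x hx)
  -- no window block is deep at level `j + 1`
  have hnd : ∀ y : Site (PV d ℓ m K hd hL) (t.j + 1), (∀ x, iterBlockOf (t.j + 1) x = y → x ∈ DeepS t x₀ 0) →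
      ¬ (domT hN D hk).Deep (t.j + 1) y := by
    intro y hy hdeep
    by_cases hk2 : t.j + 2 ≤ k
    · obtain ⟨x, hx⟩ := iterBlock_nonempty (P := PV d ℓ m K hd hL) hjm y
      rw [mem_iterBlock] at hx
      have hmem : iterBlockOf (t.j + 2) x ∈ (domT hN D hk).Om (t.j + 2) := by
        rw [show t.j + 2 = (t.j + 1) + 1 from rfl, iterBlockOf_succ, hx]; exact hdeep
      have := ((iterBlockOf_mem_domT_iff hN D hk hk2 x).1 hmem)
      have := (hlev x (hy x hx)).2
      omega
    · exact (domT hN D hk).not_deep_of_le (show (domT hN D hk).k ≤ t.j + 1 from by change k ≤ t.j + 1; omega) y hdeep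
  have hsrc : η.src ∈ (domT hN D hk).Om (t.j + 1) ↔ (eBj t x₀ (t.j + 1) η).src ∈ t.Λ' := (hΛ _ hsrc0).symm
  have htgt : η.tgt ∈ (domT hN D hk).Om (t.j + 1) ↔ (eBj t x₀ (t.j + 1) η).tgt ∈ t.Λ' := by
    rw [eBj_tgt hv]; exact (hΛ _ htgt0).symm
  show ((η.src ∈ (domT hN D hk).Om (t.j + 1) ∨ η.tgt ∈ (domT hN D hk).Om (t.j + 1)) ∧ ¬ (domT hN D hk).Deep (t.j + 1) η.src ∧
      ¬ (domT hN D hk).Deep (t.j + 1) η.tgt) ↔ _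
  rw [hsrc, htgt]
  exact ⟨fun h => h.1, fun h => ⟨h, hnd _ hsrc0, hnd _ htgt0⟩⟩

/-- **`hL0` DISCHARGED — ONLY THE LEVELS `j`, `j + 1` ARE SEEN FROM THE DEEP WINDOW**: an index bond of a level `n ∉ {j, j+1}` is never
near.  Levels `n < j`: its end-blocks would be deep at level `n` (window sites have level `≥ j > n`), contradicting `Λ_n`.  Levels `n ≥ j + 2`:
the `n`-block of a window site is not in `Ω_n` (level `≤ j + 1 < n`), so nearness forces an ADJACENT `n`-block in `Ω_n` — excluded by the
separation input `hfar` ((2.2): `dist(Ω_nᶜ… , Ω_n) > R·M·L^{n−1}` around a cube meeting the level-`j` territory; discharged from p21's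
`B6MultiLevelTorusOperator.TDomains.sepT` in the assembly). [cite: Balaban1984PropagatorsII, (2.2)–(2.3) p.224, (2.89) p.239] -/
theorem not_near_of_level_ne (hN : ∀ μ, N0 ℓ Mh k P' μ = (PV d ℓ m K hd hL).sitesPerDir 0) (D : B6MultiLevelTorusOperatorL0.TDomains d ℓ Mh k P' R) (hk : k ≤ m + K)
    (hjk : t.j + 1 ≤ k) {r : ℕ}
    (hlev : ∀ x : Site (PV d ℓ m K hd hL) 0, x ∈ DeepS t x₀ 0 → t.j ≤ D.lev (toBox hN x) ∧ D.lev (toBox hN x) ≤ t.j + 1)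
    (hfar : ∀ n, t.j + 2 ≤ n → n ≤ k → ∀ x : Site (PV d ℓ m K hd hL) 0, x ∈ DeepS t x₀ r → ∀ μ,
      (iterBlockOf n x).shift μ ∉ (domT hN D hk).Om n ∧ (iterBlockOf n x).unshift μ ∉ (domT hN D hk).Om n)
    (i : B6SectAOperatorsV1.BondIdx (domT hN D hk)) (hn : (i.1.1 : ℕ) ≠ t.j) (hn1 : (i.1.1 : ℕ) ≠ t.j + 1) :
    ¬ NearB t x₀ r i.1.1 i.1.2 := by
  obtain ⟨⟨n, β⟩, hβ⟩ := i
  change (n : ℕ) ≠ t.j at hn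
  change (n : ℕ) ≠ t.j + 1 at hn1
  rintro ⟨b₁, hb₁, hne⟩
  have hnk : (n : ℕ) ≤ k := by have := n.isLt; change (n : ℕ) < k + 1 at this; omega
  have hnm : (n : ℕ) ≤ m + K := by omega
  obtain ⟨hblk, -⟩ := blocks_of_bondAvgIter_single_ne_zero hnm hne
  have hb₀ : b₁.src ∈ DeepS t x₀ 0 := deepS_mono (Nat.zero_le _) hb₁
  obtain ⟨hor, hns, hnt⟩ := hβ
  change (β.src ∈ (domT hN D hk).Om n ∨ β.tgt ∈ (domT hN D hk).Om n) at hor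
  by_cases hlt : (n : ℕ) < t.j
  · -- low levels: the end-block containing `b₁` is deep at level `n`
    have hdeep : (domT hN D hk).Deep n (iterBlockOf n b₁.src) := by
      change blockOf (iterBlockOf n b₁.src) ∈ (domT hN D hk).Om (n + 1)
      rw [← iterBlockOf_succ]
      exact (iterBlockOf_mem_domT_iff hN D hk (by omega) b₁.src).2 (by have := (hlev b₁.src hb₀).1; omega)
    rcases hblk with e | e
    · exact hns (e ▸ hdeep)
    · exact hnt (e ▸ hdeep)
  · -- high levels `n ≥ j + 2`
    have hge : t.j + 2 ≤ (n : ℕ) := by omega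
    have hnotin : iterBlockOf n b₁.src ∉ (domT hN D hk).Om n := fun hmem => by
      have := (iterBlockOf_mem_domT_iff hN D hk hnk b₁.src).1 hmem
      have := (hlev b₁.src hb₀).2
      omega
    obtain ⟨hup, hdown⟩ := hfar n hge hnk b₁.src hb₁ β.dir
    rcases hblk with e | e
    · -- `y_n(b₁) = β₋`: then `β₊ = β₋ + e_μ` must be in `Ω_n`
      rcases hor with h | h
      · exact hnotin (e ▸ h)
      · apply hup; rw [e]; exact h
    · -- `y_n(b₁) = β₊`: then `β₋ = β₊ − e_μ` must be in `Ω_n`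
      rcases hor with h | h
      · apply hdown
        rw [e]
        have : (β.tgt).unshift β.dir = β.src := by
          show (β.src.shift β.dir).unshift β.dir = β.src
          funext ν
          by_cases hν : ν = β.dir
          · subst hν; simp [Site.shift, Site.unshift]
          · simp [Site.shift, Site.unshift, Function.update_of_ne hν]
        rw [this]; exact h
      · exact hnotin (e ▸ h)

end IndexSets

/-! ## §3  `hagree` FOR THE V1 DOMAIN DATUM OF p21's TORUS FAMILY: the index-set hypotheses of `kagree_QaQ` replaced by the window data
(`hlev` two-level, `hΛ` = (2.89), `hfar` = the separation (2.2) near `□`) -/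

section Assembled

open B6SectAOperatorsV1 (dE dsE dcE dcsE QE aE QsE BondIdx)
open B6Prop26Gluing (mulOp)
open B6Prop26ReachTransplant (transplant chartBond)
open B6Ineq2133TwoScaleV1 (onFun)

variable {Mh k R : ℕ} {P' : Fin (d + 1) → ℕ}
variable {hx₀ : ∀ μ, 0 ≤ x₀ μ} {hfit : ∀ μ, x₀ μ + (t.P.sitesPerDir 0 : ℕ) ≤ ((PV d ℓ m K hd hL).sitesPerDir 0 : ℕ)}

/-- **`Q*aQ` AGREEMENT FOR `domT`** with the index-set hypotheses DISCHARGED: `KAgree cB cB s (onFun Q*aQ) (onFun (Q*aQ)_□) (DeepB r)` for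
`r ≥ 4L^{j+1}`, given the two-level window (`hlev`), the member's `Λ′ = e_{j+1}(Ω_{j+1} ∩ window)` (`hΛ`, (2.89)), the separation input `hfar`
((2.2) near `□`) and corresponding weights. [cite: Balaban1984PropagatorsII, (2.89)–(2.91) p.239, (2.2)–(2.3) p.224] -/
theorem kagree_QaQ_domT (hN : ∀ μ, N0 ℓ Mh k P' μ = (PV d ℓ m K hd hL).sitesPerDir 0) (D : B6MultiLevelTorusOperatorL0.TDomains d ℓ Mh k P' R) (hk : k ≤ m + K)
    (wG : BondIdx (domT hN D hk) → ℝ) (s : ℝ) {r : ℕ}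
    (hjk : t.j + 1 ≤ k) (hdiv : ∀ μ, ((((ℓ + 1) ^ (t.j + 1) : ℕ) : ℤ)) ∣ x₀ μ) (hr : 4 * (ℓ + 1) ^ (t.j + 1) ≤ r)
    (hlev : ∀ x : Site (PV d ℓ m K hd hL) 0, x ∈ DeepS t x₀ 0 → t.j ≤ D.lev (toBox hN x) ∧ D.lev (toBox hN x) ≤ t.j + 1)
    (hΛ : ∀ Y : Site (PV d ℓ m K hd hL) (t.j + 1), (∀ x, iterBlockOf (t.j + 1) x = Y → x ∈ DeepS t x₀ 0) →
      (eSj t x₀ (t.j + 1) Y ∈ t.Λ' ↔ Y ∈ (domT hN D hk).Om (t.j + 1)))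
    (hfar : ∀ n, t.j + 2 ≤ n → n ≤ k → ∀ x : Site (PV d ℓ m K hd hL) 0, x ∈ DeepS t x₀ r → ∀ μ,
      (iterBlockOf n x).shift μ ∉ (domT hN D hk).Om n ∧ (iterBlockOf n x).unshift μ ∉ (domT hN D hk).Om n)
    (hWj : ∀ (hlt : t.j < (domT hN D hk).k + 1) (β : PBond (PV d ℓ m K hd hL) t.j) (hβ : (domT hN D hk).LamBond t.j β)
      (hβ' : blockOf (eBj t x₀ t.j β).src ∉ t.Λ' ∧ blockOf (eBj t x₀ t.j β).tgt ∉ t.Λ'), NearB t x₀ r t.j β →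
      wG ⟨⟨⟨t.j, hlt⟩, β⟩, hβ⟩ = s * t.w (Sum.inl ⟨eBj t x₀ t.j β, hβ'⟩))
    (hWj1 : ∀ (hlt : t.j + 1 < (domT hN D hk).k + 1) (η : PBond (PV d ℓ m K hd hL) (t.j + 1)) (hη : (domT hN D hk).LamBond (t.j + 1) η)
      (hη' : (eBj t x₀ (t.j + 1) η).src ∈ t.Λ' ∨ (eBj t x₀ (t.j + 1) η).tgt ∈ t.Λ'), NearB t x₀ r (t.j + 1) η →
      wG ⟨⟨⟨t.j + 1, hlt⟩, η⟩, hη⟩ = s * t.w (Sum.inr ⟨eBj t x₀ (t.j + 1) η, hη'⟩)) :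
    KAgree (cB t x₀ hx₀ hfit) (cB t x₀ hx₀ hfit) s (onFun (QsE (domT hN D hk) ∘ₗ aE (domT hN D hk) wG ∘ₗ QE (domT hN D hk)))
      (onFun (LinearMap.adjoint t.D.Q ∘ₗ t.D.a ∘ₗ t.D.Q)) (DeepB t x₀ r) := by
  have hjm : t.j + 1 ≤ m + K := by omega
  have hpow : 2 * (ℓ + 1) ^ t.j ≤ (ℓ + 1) ^ (t.j + 1) := by
    rw [pow_succ]; have := hL.2; nlinarith [Nat.one_le_pow t.j (ℓ + 1) (Nat.succ_pos ℓ)]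
  refine kagree_QaQ (domT hN D hk) wG s hjm hdiv (by omega) (fun i hn hn1 => not_near_of_level_ne hN D hk hjk hlev hfar i hn hn1)
    (fun β hnear => ?_) (fun η hnear => ?_) hWj hWj1
  · obtain ⟨b₁, hb₁, hne⟩ := hnear
    refine lamBond_iff_chart_out hN D hk hfit hjk hdiv hlev hΛ ?_
    exact deep_block_of_near (by omega) hx₀ (deepS_mono (by omega) hb₁) hne
  · obtain ⟨b₁, hb₁, hne⟩ := hnear
    refine lamBond_succ_iff_chart_in hN D hk hfit hjk hdiv hlev hΛ ?_
    exact deep_block_of_near hjm hx₀ (deepS_mono (by omega) hb₁) hne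

/-- **`hagree` FOR `domT`, ASSEMBLED AND GEOMETRICALLY DISCHARGED**: `M·h_□ = (c′/L^j)²•(ε(Δ_□ + Q*a_□Q)ρ)·h_□` with `M = ∂*∂ + ∂∂* + Q*aQ` of the
multi-level `Δ_a` over `domT hN D hk` (global fine factor `c′`), for every cut-off `h_□` supported at margin `4L^{j+1}`, given the two-level window,
`Λ′(□)` = (2.89), the separation input and the weight correspondence `w = (c′/L^j)²·w_□`. [cite: Balaban1984PropagatorsII, (2.89)–(2.91) p.239, (2.94) p.239, (2.2)–(2.3) p.224] -/
theorem hagree_domT (hN : ∀ μ, N0 ℓ Mh k P' μ = (PV d ℓ m K hd hL).sitesPerDir 0) (D : B6MultiLevelTorusOperatorL0.TDomains d ℓ Mh k P' R) (hk : k ≤ m + K)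
    (wG : BondIdx (domT hN D hk) → ℝ) {c' : ℝ} (hc' : c' ≠ 0) {r : ℕ}
    (hjk : t.j + 1 ≤ k) (hdiv : ∀ μ, ((((ℓ + 1) ^ (t.j + 1) : ℕ) : ℤ)) ∣ x₀ μ) (hr : 4 * (ℓ + 1) ^ (t.j + 1) ≤ r)
    (hlev : ∀ x : Site (PV d ℓ m K hd hL) 0, x ∈ DeepS t x₀ 0 → t.j ≤ D.lev (toBox hN x) ∧ D.lev (toBox hN x) ≤ t.j + 1)
    (hΛ : ∀ Y : Site (PV d ℓ m K hd hL) (t.j + 1), (∀ x, iterBlockOf (t.j + 1) x = Y → x ∈ DeepS t x₀ 0) →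
      (eSj t x₀ (t.j + 1) Y ∈ t.Λ' ↔ Y ∈ (domT hN D hk).Om (t.j + 1)))
    (hfar : ∀ n, t.j + 2 ≤ n → n ≤ k → ∀ x : Site (PV d ℓ m K hd hL) 0, x ∈ DeepS t x₀ r → ∀ μ,
      (iterBlockOf n x).shift μ ∉ (domT hN D hk).Om n ∧ (iterBlockOf n x).unshift μ ∉ (domT hN D hk).Om n)
    (hWj : ∀ (hlt : t.j < (domT hN D hk).k + 1) (β : PBond (PV d ℓ m K hd hL) t.j) (hβ : (domT hN D hk).LamBond t.j β)
      (hβ' : blockOf (eBj t x₀ t.j β).src ∉ t.Λ' ∧ blockOf (eBj t x₀ t.j β).tgt ∉ t.Λ'), NearB t x₀ r t.j β →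
      wG ⟨⟨⟨t.j, hlt⟩, β⟩, hβ⟩ = (c' / (((ℓ + 1 : ℕ) : ℝ) ^ t.j)) ^ 2 * t.w (Sum.inl ⟨eBj t x₀ t.j β, hβ'⟩))
    (hWj1 : ∀ (hlt : t.j + 1 < (domT hN D hk).k + 1) (η : PBond (PV d ℓ m K hd hL) (t.j + 1)) (hη : (domT hN D hk).LamBond (t.j + 1) η)
      (hη' : (eBj t x₀ (t.j + 1) η).src ∈ t.Λ' ∨ (eBj t x₀ (t.j + 1) η).tgt ∈ t.Λ'), NearB t x₀ r (t.j + 1) η →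
      wG ⟨⟨⟨t.j + 1, hlt⟩, η⟩, hη⟩ = (c' / (((ℓ + 1 : ℕ) : ℝ) ^ t.j)) ^ 2 * t.w (Sum.inr ⟨eBj t x₀ (t.j + 1) η, hη'⟩))
    (h : PBond (PV d ℓ m K hd hL) 0 → ℝ) (hh : ∀ b, h b ≠ 0 → b ∈ DeepB t x₀ r) :
    onFun (dcsE (P := PV d ℓ m K hd hL) c' ∘ₗ dcE c' + dE c' ∘ₗ dsE c' +
        QsE (domT hN D hk) ∘ₗ aE (domT hN D hk) wG ∘ₗ QE (domT hN D hk)) * mulOp h =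
      (c' / (((ℓ + 1 : ℕ) : ℝ) ^ t.j)) ^ 2 •
        (transplant (cB t x₀ hx₀ hfit).W (chartBond t posV PBond.dir x₀)
          (onFun (t.D.lapV + LinearMap.adjoint t.D.Q ∘ₗ t.D.a ∘ₗ t.D.Q)) * mulOp h) := by
  have h3 : ∀ b, h b ≠ 0 → b ∈ DeepB t x₀ 3 := fun b hb =>
    deepS_mono (by have := Nat.one_le_pow (t.j + 1) (ℓ + 1) (Nat.succ_pos ℓ); omega) (hh b hb)
  rw [onFun_add (dcsE (P := PV d ℓ m K hd hL) c' ∘ₗ dcE c' + dE c' ∘ₗ dsE c') (QsE (domT hN D hk) ∘ₗ aE (domT hN D hk) wG ∘ₗ QE (domT hN D hk)),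
    add_mul, agree_lapV_member (hx₀ := hx₀) (hfit := hfit) hc' h h3,
    (kagree_QaQ_domT (hx₀ := hx₀) (hfit := hfit) hN D hk wG _ hjk hdiv hr hlev hΛ hfar hWj hWj1).mul_mulOp
      (fun _ hb => mem_cB_W.2 (deepS_mono (Nat.zero_le _) hb)) h hh,
    cB_e, transplant_eB_eq, onFun_add t.D.lapV, transplant_add, add_mul, smul_add]

end Assembled

end Literature.MathematicalPhysics.QuantumFieldTheory.Balaban1983to89.B6IndexCorrV1L0
end

-- L0-port marker: J7 call sites rewritten
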